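/-
Copyright (c) 2026 the pub-hodgecm-mathlib formalisation cell (harness21).  Prover seat hodgecm-mathlib-R90-C131-p02 (g2) (S8 walk-in, chair VALVE 38∕40), Track B ∕ R90-TF,
h413 = `stmt-HodgeConjecture-24833`, R90-TF section S8 «ContSpec-n½», #4′ road, brick UB-SD-1 (i) (S8 dealer R90-CS-plan (g4), S8-R303 (1), 2026-09-05): THE LINE MODEL OF THE
`U(1,1)` BLOCK `Sc(K′, ω, χ)` FROM A GRAM IDENTITY — the N = 2 instantiation of ★ `R90S8PlancherelLineModelOfGram` (K2E1-p16) in the byte shape of ★ UB-SD-2's package row `hU`.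
-/
import Summits.HodgeConjecture.HodgeConjecture.Theorems.R90S8PlancherelLineModelOfGram      -- ★ p865235∕p865260 (K2E1-p16): `exists_lineModelLetters_of_gram_residueGram` (abstract Hilbert space)
import Summits.HodgeConjecture.HodgeConjecture.Theorems.R90S8ResHBlockModelFamilyU2        -- ★ (K2E1-p15): `completeSpace_resHBlock`; brings ★ DEFS `resHBlock` (`R90S8ResHBlockDataU2Defs`)
import HarnessLib

/-!
# S8 #4′ road — `R90S8ResHLineModelOfGramU2` (UB-SD-1 (i)): THE LINE MODEL `U` OF THE `U(1,1)` BLOCK `resHBlock L μ K′ ω χ` FROM A GRAM IDENTITY, IN THE PACKAGE ROW SHAPE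

Track B ∕ R90-TF, crux h413 = `stmt-HodgeConjecture-24833`, route of record `HCCMUnconditional`; cell `hodgecm-mathlib`, section S8 «ContSpec-n½», socket #4′
`sock_S8_resH_spannedByCharLines`.  THEOREMS ONLY (no `def`, no `instance`, no `notation`, no named-fact hypothesis, no `sorry`); ★-only imports; lane
`--supports stmt-HodgeConjecture-24833 --as helper` (count-neutral).  CLOSES NO SOCKET.

WHAT.  ★ `exists_lineModelLetters_of_gram_residueGram` (K2E1-p16, bricks PB-3 + PB-4 of the E1-Plancherel body) is N-FREE: an abstract Hilbert space `H`, a family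
`x : ι → H` with closed span `Sc′`, an abstract Gram identity `⟪x i, x j⟫ = ⟪r i, r j⟫ + ⟪c i, c j⟫` (residual models `r`, axis coordinates `c : ι → Lp E 2 m`), residue
letters, and bounded operators `T j` permuting the `x i` with Hölder symbols `s j` give a line model `U : H →ₗ Lp E 2 m` with `U (x i) = c i`, `U (T j v) = s_j • U v`, `U = 0`
on `Sc′ᗮ`.  THIS FILE instantiates it at `H := L²(U(J₂)(L⁺)∖U(J₂)(𝔸_{L⁺}), μ)` and `Sc′ := resHBlock L μ K′ ω χ` (★ DEFS p862464: the closed span of the pseudo-Eisenstein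
wave packets of the datum `(K′, ω, χ)`; for ANY family `x` whose closed span IS the block — e.g. `Subtype.val` on the generating set, where the hypothesis is `rfl`, so NO
N = 2 density twin of PB-0′ is needed), and delivers the row in the BYTE SHAPE of ★ UB-SD-2 `subrep_le_orthogonal_resHLine_of_blockPackage_one`'s package binder `hU`
(K2E4-p14): for EVERY first coordinate `W : L² →ₗ A` and `V := LinearMap.prod W U`,
**`((V ∘ₗ P_Sc) (T j v)).2 = (hs j).toLp (s j) • ((V ∘ₗ P_Sc) v).2` for every `v`** (the package guards `v ∈ Fix P`; here unguarded), because `U ∘ P_Sc = U`.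
* §1 (abstract inner-product-space algebra) `apply_starProjection_eq_of_forall_mem_orthogonal` (`U = 0` on `Scᗮ` ⇒ `U ∘ P_Sc = U`), **`snd_prod_comp_starProjection_row`**
  (the package row for ANY action `act j` with `U (T j v) = act j (U v)`).
* §2 **`exists_lineModelLetters_resH_of_gram`** — the N = 2 instantiation, HYPOTHESIS-FIRST on the N = 2 twins of PB-2 (`hG`, residue letters `hee hxe hr hRA`) and PB-3a
  (`hTx hTadjx hSymb`), none claimed here; outputs `U (x i) = c i`, `U (T j v) = s_j • U v` (all `v`), `U = 0` on `Scᗮ`, `U ∘ P_Sc = U`, THE PACKAGE ROW, and the (C)-shape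
  `hLnU` at `Ln := Sc ⊓ A′ᗮ`.
HONEST LABEL: HC_CM is proved only modulo the 7 printed citations (2 remaining named inputs: hLiu418 = `stmt-HodgeConjecture-24832`, h413 = `stmt-HodgeConjecture-24833`) until
rung 0 closes; REL ≠ ★ ≠ BUILT; UB-SD-1's CORE (the rank-one `U(1,1)` Plancherel isometry with scattering matrix feeding `hG`, «UB-G9») and (PB-3a)₂ stay binders; this file asserts
no named fact and closes no socket; count-neutral.

## References
* [MoeglinWaldspurger1995] C. Mœglin, J.-L. Waldspurger, *Spectral Decomposition and Eisenstein Series* (1995), II.2.4, IV.3.1, VI.2.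
* [Langlands1976] R. P. Langlands, *On the functional equations satisfied by Eisenstein series*, LNM 544 (1976), §7.
* [ReedSimonI1980] M. Reed, B. Simon, *Methods of Modern Mathematical Physics I* (1980), Thm. I.7, Thm. II.3.
-/

set_option autoImplicit false
set_option linter.dupNamespace false  -- the mandated namespace `…HodgeConjecture.HodgeConjecture.R90.S8` (LEAD #1 L1) repeats the summit's segment

noncomputable section

open MeasureTheory Set Submodule Filter Topology NumberField
open Literature.NumberTheory.Automorphic Literature.NumberTheory.Automorphic.UnitaryGroup Literature.NumberTheory.GaloisRepresentations AdelicGroupData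
open scoped InnerProductSpace ENNReal

namespace Summit.HodgeConjecture.HodgeConjecture.R90.S8

/-! ## §1 Abstract: a line model vanishing on `Scᗮ` factors through `P_Sc`; the package row -/

section Abstract

variable {H : Type*} [NormedAddCommGroup H] [InnerProductSpace ℂ H] {Λ : Type*} [AddCommGroup Λ] [Module ℂ Λ]

/-- A linear map vanishing on `Scᗮ` factors through the orthogonal projection: `U (P_Sc w) = U w` (`w − P_Sc w ∈ Scᗮ`). [cite: ReedSimonI1980, Thm. II.3] -/
theorem apply_starProjection_eq_of_forall_mem_orthogonal (Sc : Submodule ℂ H) [Sc.HasOrthogonalProjection] (U : H →ₗ[ℂ] Λ)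
    (hU0 : ∀ v ∈ Scᗮ, U v = 0) (w : H) : U (Sc.starProjection w) = U w := by
  have h : U (w - Sc.starProjection w) = 0 := hU0 _ (Submodule.sub_starProjection_mem_orthogonal w)
  rw [map_sub, sub_eq_zero] at h
  exact h.symm

/-- **THE PACKAGE ROW from a line model**: if `U (T j v) = act j (U v)` for all `v` and `U = 0` on `Scᗮ`, then for EVERY first coordinate `W` the pair map
`V := LinearMap.prod W U` satisfies `((V ∘ₗ P_Sc) (T j v)).2 = act j (((V ∘ₗ P_Sc) v).2)` for all `v` — the shape of ★ UB-SD-2's binder `hU` (there `act j = ((hs j).toLp (s j) • ·)`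
and guarded by `v ∈ Fix P`). [cite: MoeglinWaldspurger1995, VI.2] [cite: ReedSimonI1980, Thm. II.3] -/
theorem snd_prod_comp_starProjection_row (Sc : Submodule ℂ H) [Sc.HasOrthogonalProjection] (U : H →ₗ[ℂ] Λ) (hU0 : ∀ v ∈ Scᗮ, U v = 0)
    {J : Type*} (T : J → H →L[ℂ] H) (act : J → Λ → Λ) (hUT : ∀ j v, U (T j v) = act j (U v))
    {A : Type*} [AddCommGroup A] [Module ℂ A] (W : H →ₗ[ℂ] A) (j : J) (v : H) :
    ((LinearMap.prod W U ∘ₗ (Sc.starProjection : H →L[ℂ] H).toLinearMap) (T j v)).2 = act j (((LinearMap.prod W U ∘ₗ (Sc.starProjection : H →L[ℂ] H).toLinearMap) v).2) := by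
  change U (Sc.starProjection (T j v)) = act j (U (Sc.starProjection v))
  rw [apply_starProjection_eq_of_forall_mem_orthogonal Sc U hU0, apply_starProjection_eq_of_forall_mem_orthogonal Sc U hU0, hUT]

end Abstract

/-! ## §2 The `U(1,1)` block: the line model of `resHBlock L μ K′ ω χ` from a Gram identity (N = 2 instantiation of ★ K2E1-p16) -/

section ResH

variable (L : Type) [Field L] [NumberField L] [IsCMField L]
  (μ : Measure (quasiSplit (↥(maximalRealSubfield L)) L (IsCMField.complexConj L) 2).automorphicQuotient)

/-- **UB-SD-1 (i) — THE LINE MODEL OF THE `U(1,1)` BLOCK `Sc = resHBlock L μ K′ ω χ` FROM A GRAM IDENTITY**, hypothesis-first on the N = 2 twins of PB-2 ∕ PB-3a.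
DATA: any family `x : ι → L²` whose closed span is the block (`hx`; `rfl` for `Subtype.val` on the generating wave packets), residual models `r : ι → M₁` and axis coordinates
`c : ι → Lp E 2 m` with the Gram identity **`hG : ⟪x i, x j⟫ = ⟪r i, r j⟫ + ⟪c i, c j⟫`** (contour shift `Re z = c₀ → ½` for `U(1,1)`: residue Gram + unitary-axis Plancherel,
[MoeglinWaldspurger1995] IV.3.1, VI.2), residues `e : k → L²` with models `b` (`hee`, `hxe`, `hr`) inside a visible residue space `A′` (`hRA`), bounded operators `T j` on `L²`
permuting the packets (`hTx : T j (x i) = x (σ j i)` — unramified Hecke operators on flat sections) with `hTadjx` (the adjoints keep the block) and Hölder symbols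
`hSymb : c (σ j i) = (hs j).toLp (s j) • c i` (`(λ_v ⋆ f)^ = λ_v · f̂`).  OUTPUT: `U : L² →ₗ[ℂ] Lp E 2 m` with `U (x i) = c i`, **`U (T j v) = (hs j).toLp (s j) • U v` for all `v`**,
`U = 0` on `Scᗮ`, `U ∘ P_Sc = U`, **THE PACKAGE ROW of ★ UB-SD-2** (`hU`, unguarded, for every first coordinate `W` and `V := LinearMap.prod W U`), and the (C)-shape
`∀ v ∈ Sc ⊓ A′ᗮ, ∀ y, U y = 0 → ⟪v, y⟫ = 0`.  Proof: ★ `exists_lineModelLetters_of_gram_residueGram` at `H := L²`, `Sc′ := resHBlock …`, then §1.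
[cite: MoeglinWaldspurger1995, II.2.4, IV.3.1, VI.2] [cite: Langlands1976, §7] [cite: ReedSimonI1980, Thm. I.7, Thm. II.3] -/
theorem exists_lineModelLetters_resH_of_gram
    (K' : Subgroup (quasiSplit (↥(maximalRealSubfield L)) L (IsCMField.complexConj L) 2).Adelic) (ω : ↥K' →* ℂ) (χ : HeckeCharacter L)
    {ι : Type*} (x : ι → (quasiSplit (↥(maximalRealSubfield L)) L (IsCMField.complexConj L) 2).L2 μ)
    (hx : (span ℂ (Set.range x)).topologicalClosure = resHBlock L μ K' ω χ)
    {Ω : Type*} {mΩ : MeasurableSpace Ω} {m : Measure Ω} {E : Type*} [NormedAddCommGroup E] [InnerProductSpace ℂ E] [CompleteSpace E] [ENNReal.HolderTriple ∞ 2 2]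
    {M₁ : Type*} [NormedAddCommGroup M₁] [InnerProductSpace ℂ M₁] [CompleteSpace M₁]
    (r : ι → M₁) (c : ι → Lp E 2 m)
    (hG : ∀ i j, ⟪x i, x j⟫_ℂ = ⟪r i, r j⟫_ℂ + ⟪c i, c j⟫_ℂ)
    {k : Type*} (e : k → (quasiSplit (↥(maximalRealSubfield L)) L (IsCMField.complexConj L) 2).L2 μ) (b : k → M₁)
    (hee : ∀ p q, ⟪e p, e q⟫_ℂ = ⟪b p, b q⟫_ℂ) (hxe : ∀ i p, ⟪x i, e p⟫_ℂ = ⟪r i, b p⟫_ℂ) (hr : ∀ i, r i ∈ (span ℂ (Set.range b)).topologicalClosure)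
    {J : Type*} (T : J → (quasiSplit (↥(maximalRealSubfield L)) L (IsCMField.complexConj L) 2).L2 μ →L[ℂ] (quasiSplit (↥(maximalRealSubfield L)) L (IsCMField.complexConj L) 2).L2 μ)
    (σ : J → ι → ι) (hTx : ∀ j i, T j (x i) = x (σ j i))
    (hTadjx : ∀ j i, ContinuousLinearMap.adjoint (T j) (x i) ∈ (span ℂ (Set.range x)).topologicalClosure)
    (s : J → Ω → ℂ) (hs : ∀ j, MemLp (s j) ∞ m) (hSymb : ∀ j i, c (σ j i) = (hs j).toLp (s j) • c i)
    (A' : Submodule ℂ ((quasiSplit (↥(maximalRealSubfield L)) L (IsCMField.complexConj L) 2).L2 μ)) (hRA : (span ℂ (Set.range e)).topologicalClosure ≤ A') :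
    haveI := completeSpace_resHBlock L μ K' ω χ
    ∃ U : (quasiSplit (↥(maximalRealSubfield L)) L (IsCMField.complexConj L) 2).L2 μ →ₗ[ℂ] Lp E 2 m,
      (∀ i, U (x i) = c i) ∧ (∀ j v, U (T j v) = (hs j).toLp (s j) • U v) ∧ (∀ v ∈ (resHBlock L μ K' ω χ)ᗮ, U v = 0) ∧
      (∀ v, U ((resHBlock L μ K' ω χ).starProjection v) = U v) ∧
      (∀ {A : Type*} [AddCommGroup A] [Module ℂ A] (W : (quasiSplit (↥(maximalRealSubfield L)) L (IsCMField.complexConj L) 2).L2 μ →ₗ[ℂ] A) (j : J)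
          (v : (quasiSplit (↥(maximalRealSubfield L)) L (IsCMField.complexConj L) 2).L2 μ),
        ((LinearMap.prod W U ∘ₗ ((resHBlock L μ K' ω χ).starProjection :
            (quasiSplit (↥(maximalRealSubfield L)) L (IsCMField.complexConj L) 2).L2 μ →L[ℂ] (quasiSplit (↥(maximalRealSubfield L)) L (IsCMField.complexConj L) 2).L2 μ).toLinearMap) (T j v)).2 =
          (hs j).toLp (s j) • ((LinearMap.prod W U ∘ₗ ((resHBlock L μ K' ω χ).starProjection :
            (quasiSplit (↥(maximalRealSubfield L)) L (IsCMField.complexConj L) 2).L2 μ →L[ℂ] (quasiSplit (↥(maximalRealSubfield L)) L (IsCMField.complexConj L) 2).L2 μ).toLinearMap) v).2) ∧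
      (∀ v ∈ resHBlock L μ K' ω χ ⊓ A'ᗮ, ∀ y, U y = 0 → ⟪v, y⟫_ℂ = 0) := by
  haveI := completeSpace_resHBlock L μ K' ω χ
  obtain ⟨U, h1, h2, h3, h4⟩ := exists_lineModelLetters_of_gram_residueGram x r c hG e b hee hxe hr T σ hTx hTadjx s hs hSymb (resHBlock L μ K' ω χ) A' hx hRA
  exact ⟨U, h1, h2, h3, apply_starProjection_eq_of_forall_mem_orthogonal _ U h3,
    fun W j v => snd_prod_comp_starProjection_row _ U h3 T (fun j f => (hs j).toLp (s j) • f) h2 W j v, h4⟩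

end ResH

end Summit.HodgeConjecture.HodgeConjecture.R90.S8

end
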